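import Literature.MathematicalPhysics.QuantumFieldTheory.Balaban1983to89.B7GaugeFixingPureGauge
import Literature.MathematicalPhysics.QuantumFieldTheory.Balaban1983to89.B8Ineq145LineageCStar

/-!
# `Balaban1983to89.B7GaugeFixingPureGaugeCStar` — the C⋆-ALGEBRA EDITION of `B7GaugeFixingPureGauge`: [Balaban1985Averaging] Sect. C's gauge fixing of depth 1 and 2
# EVALUATED on a CENTRAL pure gauge `U₁ = g·1·g⁻¹`, `g = e^{iψ}·1 ∈ U(𝔸)` (central units of an arbitrary nontrivial C⋆-algebra `𝔸`, e.g. `M_N(ℂ)`), at `U₀ = 1`: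
# frames `w₁`, `w₂`, fixings `glev₁`, `glev₂`, and the inter-tower transition function `e^{i(M₂ψ − M₁ψ)}·1`

statement-level skeleton of published theorems with citation tags; proofs where landed; nothing here is a claim about the Yang–Mills mass gap

T. Bałaban, *Averaging operations for lattice gauge theories*, Commun. Math. Phys. **98** (1985) 17–51 `[Balaban1985Averaging]` ("[3]"): (8)–(9) pp. 18–19,
(21) p. 21, (42)–(43) pp. 23–24, (55) p. 27, (58) p. 27, (70)–(71) p. 29, (76)–(78) pp. 29–30, (81) p. 30, (82) p. 30, (85) p. 31, (87) p. 31, (88) p. 31.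
T. Bałaban, *Spaces of regular gauge field configurations on a lattice and gauge fixing conditions*, Commun. Math. Phys. **99** (1985) 75–102
`[Balaban1985RegularSpaces]`: Prop. 7 (1.145) p. 100.

## WHY THIS FILE (cell `pub-ymgap`, HUMAN RULING D-0062 ∕ D-0149 ∕ D-0154; N05 = [B8]; width seat `pub-ymgap-dag-n05-w5` g3)

`B7GaugeFixingPureGauge` evaluates [3]'s gauge fixing on a pure gauge in the scalar model `𝔸 = ℂ`; NODE 00's records carry a general coefficient C⋆-algebra
`θ.𝔸`.  Exactly as the lineage's `B8Ineq145LineageCStar` did for the CONSTANT witness, this file re-runs §§2–4 of `B7GaugeFixingPureGauge` for the CENTRAL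
unit `e^{iψ(x)}·1 = expUnit (algebraMap ℂ 𝔸 (iψ(x)))`: all objects stay in the commutative subalgebra `ℂ·1`, so the same telescoping and the same series
logarithm (`B8Ineq145LineageCStar.mlog_expUnit_algebraMap`) apply; §1 of `B7GaugeFixingPureGauge` (pure gauges under [3]'s operations) is already `𝔸`-general
and is USED, not restated.

## WHAT IS PROVED (kernel, 0 sorry; theorems only, no `def`)

`savg_cu` ((78) of `x ↦ e^{if(x)}·1` = `e^{i·mean f}·1`), `wrec_one_cu` ∕ `wrec_two_cu` ((85)), `glev_one_cu` ∕ `glev_two_cu` ((76)–(77)+(87)), `cfgExp_potential_eq_gaugeAct_cu`,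
★★ `mgauge_interTower_cu` ∕ `norm_mgauge_interTower_sub_one_cu` (transition function `e^{i(M₂ψ − M₁ψ)}·1`, left member of (1.145) `= 2|sin((M₂ψ − M₁ψ)∕2)|`).

## HONEST SCOPE

Pure algebra plus the scalar series logarithm inside `ℂ·1 ⊂ 𝔸`; NO estimate of [Balaban1985Averaging] or [Balaban1985RegularSpaces] is proved or asserted; the smallness
hypotheses are displayed.  Count-neutral helper keyed `stmt-QuantumFields-26907` (K1⁸; successor of the aside K1⁷ 20542); N05 NOT discharged; no summit statement
is proved by this seat — R4 closes the conditional finite-`𝕋⁴` rung `BalabanLadder.UV` only; nothing continuum ∕ ℝ⁴ ∕ OS ∕ mass-gap ∕ Clay.  No `sorry`, no `def`,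
no `instance`, no `notation`.  Unit `pub-ymgap-dag-n05-w5` (g3), 2026-08-28.

[cite: Balaban1985Averaging, (8)–(9) pp.18–19, (21) p.21, (42)–(43) pp.23–24, (55) p.27, (58) p.27, (70)–(71) p.29, (76)–(78) pp.29–30, (81) p.30, (82) p.30, (85) p.31, (87) p.31, (88) p.31;
Balaban1985RegularSpaces, Prop. 7 (1.145) p.100]
-/

noncomputable section

open NormedSpace Finset

namespace Literature.MathematicalPhysics.QuantumFieldTheory.Balaban1983to89.B7GaugeFixingPureGaugeCStar

open Complex (I)
open B7Prop1Explicit B7Prop2Explicit MatrixLog B7Eq92Concrete B7Eq99Concrete B7Eq84Concrete B7AvgGaugeCovariance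
open B7Prop3Flat (Favg vframe)
open B8Ineq130 (fl hol_one)
open B8Eq115GaugeFixing (fl_smul fl_block)
open B8Ineq145LineageCStar (mlog_expUnit_algebraMap)
open B7GaugeFixingPureGauge (hol_gaugeAct_one gaugeAct_one_apply tHol_one_gaugeAct_one avgIter_gaugeAct_one tildIter_one_gaugeAct_one sum_inv_card_box
  sum_inv_card_mul_sub)

-- `Site` alone would resolve to the torus sites of `Setup.lean`; re-export the `ℤ^d` sites of `B7Prop1Explicit`.
export B7Prop1Explicit (Site)

variable {d : ℕ} {𝔸 : Type} [CStarAlgebra 𝔸] [Nontrivial 𝔸]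

/-! ## §0 Central units `e^{it}·1` -/

section Central

/-- `‖it·1‖ = |t|` in a nontrivial C⋆-algebra. [folklore] -/
private theorem norm_algebraMap_I_mul (t : ℝ) : ‖algebraMap ℂ 𝔸 (I * (t : ℂ))‖ = |t| := by
  rw [norm_algebraMap', norm_mul, Complex.norm_I, one_mul, Complex.norm_real, Real.norm_eq_abs]

omit [Nontrivial 𝔸] in
/-- Products of central units `e^{ia}·1 · e^{ib}·1 = e^{i(a+b)}·1` — (9) for the central pure gauge. [cite: Balaban1985Averaging, (9) p.18 (bookkeeping: central units)] -/
theorem cu_mul (a b : ℝ) :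
    expUnit (algebraMap ℂ 𝔸 (I * (a : ℂ))) * expUnit (algebraMap ℂ 𝔸 (I * (b : ℂ))) = expUnit (algebraMap ℂ 𝔸 (I * ((a + b : ℝ) : ℂ))) := by
  letI : NormedAlgebra ℚ 𝔸 := NormedAlgebra.restrictScalars ℚ ℂ 𝔸
  apply Units.ext
  have h : I * (a : ℂ) + I * (b : ℂ) = I * ((a + b : ℝ) : ℂ) := by push_cast; ring
  rw [Units.val_mul, val_expUnit, val_expUnit, val_expUnit, ← exp_add_of_commute (Algebra.commute_algebraMap_left _ _), ← map_add, h]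

omit [Nontrivial 𝔸] in
/-- `e^{i·0}·1 = 1`. [folklore] -/
private theorem cu_zero : expUnit (algebraMap ℂ 𝔸 (I * ((0 : ℝ) : ℂ))) = 1 := by
  apply Units.ext
  rw [val_expUnit, Units.val_one, Complex.ofReal_zero, mul_zero, map_zero, exp_zero]

omit [Nontrivial 𝔸] in
/-- Inverses of central units: `(e^{ib}·1)⁻¹ = e^{−ib}·1`. [cite: Balaban1985Averaging, (9) p.18 (bookkeeping: central units)] -/
theorem cu_inv (b : ℝ) : (expUnit (algebraMap ℂ 𝔸 (I * (b : ℂ))))⁻¹ = expUnit (algebraMap ℂ 𝔸 (I * ((-b : ℝ) : ℂ))) := by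
  rw [inv_eq_iff_mul_eq_one, cu_mul, add_neg_cancel, cu_zero]

omit [Nontrivial 𝔸] in
/-- `e^{ia}·1 · (e^{ib}·1)⁻¹ = e^{i(a−b)}·1` — the telescoped pure-gauge holonomies (9) of the central pure gauge. [cite: Balaban1985Averaging, (9) p.18 (bookkeeping: central units)] -/
theorem cu_mul_inv (a b : ℝ) :
    expUnit (algebraMap ℂ 𝔸 (I * (a : ℂ))) * (expUnit (algebraMap ℂ 𝔸 (I * (b : ℂ))))⁻¹ = expUnit (algebraMap ℂ 𝔸 (I * ((a - b : ℝ) : ℂ))) := by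
  rw [cu_inv, cu_mul, ← sub_eq_add_neg]

/-- `‖e^{iφ}·1 − 1‖ = 2|sin(φ∕2)|` — the size of a central phase jump, the form in which (1.145) is read on the central witnesses.
[cite: Balaban1985RegularSpaces, (1.145) p.100 (bookkeeping: central units)] -/
theorem norm_cu_sub_one (φ : ℝ) : ‖((expUnit (algebraMap ℂ 𝔸 (I * (φ : ℂ))) : 𝔸ˣ) : 𝔸) - 1‖ = 2 * |Real.sin (φ / 2)| := by
  rw [val_expUnit, ← algebraMap_exp_comm, ← map_one (algebraMap ℂ 𝔸), ← map_sub, norm_algebraMap', ← Complex.exp_eq_exp_ℂ,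
    Complex.norm_exp_I_mul_ofReal_sub_one, Real.norm_eq_abs, abs_mul, abs_two]

omit [Nontrivial 𝔸] in
/-- Real scalars act through `algebraMap`: `r • (z·1) = (rz)·1`. [folklore] -/
private theorem real_smul_algebraMap (r : ℝ) (z : ℂ) : r • algebraMap ℂ 𝔸 z = algebraMap ℂ 𝔸 ((r : ℂ) * z) := by
  rw [← Complex.coe_smul, Algebra.smul_def, map_mul]

omit [Nontrivial 𝔸] in
/-- **The central pure gauge IS a small-field exponential `U₁ = e^{iηA}`** with `A(x, x+e_μ) := ((ψ(x) − ψ(x+e_μ))∕η)·1`.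
[cite: Balaban1985RegularSpaces, p.100 («U₁ = e^{iηA}»); Balaban1985Averaging, (8) p.18] -/
theorem cfgExp_potential_eq_gaugeAct_cu {η : ℝ} (hη : η ≠ 0) (ψ : Site d → ℝ) :
    B8Eq184Proof.cfgExp η (fun y τ => algebraMap ℂ 𝔸 ((((ψ y - ψ (y + e τ)) / η : ℝ)) : ℂ))
      = gaugeAct (fun x => expUnit (algebraMap ℂ 𝔸 (I * ((ψ x : ℝ) : ℂ)))) (1 : Site d → Fin d → 𝔸ˣ) := by
  funext y τ
  rw [gaugeAct_one_apply, cu_mul_inv, B8Eq184Proof.cfgExp, real_smul_algebraMap, Algebra.smul_def, ← map_mul]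
  have hη' : (η : ℂ) ≠ 0 := by exact_mod_cast hη
  have : I * ((η : ℂ) * ((((ψ y - ψ (y + e τ)) / η : ℝ)) : ℂ)) = I * (((ψ y - ψ (y + e τ) : ℝ)) : ℂ) := by
    push_cast; rw [mul_div_cancel₀ _ hη']
  rw [this]

end Central

/-! ## §2 The site average (78) of a central phase field -/

section SiteAverage

variable (L : ℕ)

/-- **The exponent of (78) for `x ↦ e^{if(x)}·1`**: `S(y) = Σ_r L^{−d}·log(e^{−if(y)}e^{if(y+r)}·1) = (i·Σ_r L^{−d}(f(y+r) − f(y)))·1` — every logarithm is the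
series logarithm (21), which needs `|f(y+r) − f(y)| < ln 2`. [cite: Balaban1985Averaging, (78) p.30, (21) p.21] -/
theorem Sexp_cu (f : Site d → ℝ) (y : Site d) (hf : ∀ r : Fin d → Fin L, |f (y + boxVec L r) - f y| < Real.log 2) :
    Sexp L (fun x => expUnit (algebraMap ℂ 𝔸 (I * ((f x : ℝ) : ℂ)))) y
      = algebraMap ℂ 𝔸 (I * ((∑ r : Fin d → Fin L, ((L : ℝ) ^ d)⁻¹ * (f (y + boxVec L r) - f y) : ℝ) : ℂ)) := by
  rw [Sexp_apply]
  have hterm : ∀ r : Fin d → Fin L,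
      mlog ((((expUnit (algebraMap ℂ 𝔸 (I * ((f y : ℝ) : ℂ))))⁻¹ * expUnit (algebraMap ℂ 𝔸 (I * ((f (y + boxVec L r) : ℝ) : ℂ))) : 𝔸ˣ)) : 𝔸)
        = algebraMap ℂ 𝔸 (I * (((f (y + boxVec L r) - f y : ℝ)) : ℂ)) := by
    intro r
    rw [cu_inv, cu_mul, show -f y + f (y + boxVec L r) = f (y + boxVec L r) - f y by ring, mlog_expUnit_algebraMap _ (hf r)]
  simp_rw [hterm, real_smul_algebraMap, ← map_sum]
  congr 1
  push_cast
  rw [Finset.mul_sum]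
  exact Finset.sum_congr rfl fun r _ => by ring

/-- ★ **(78) of a central phase field is the phase of the block MEAN**: `{e^{if}·1}_{B(y)} = e^{i·Σ_r L^{−d} f(y+r)}·1` (`L ≥ 1`; smallness on the block).
[cite: Balaban1985Averaging, (78) p.30] -/
theorem savg_cu (hL : 1 ≤ L) (f : Site d → ℝ) (y : Site d) (hf : ∀ r : Fin d → Fin L, |f (y + boxVec L r) - f y| < Real.log 2) :
    savg L (fun x => expUnit (algebraMap ℂ 𝔸 (I * ((f x : ℝ) : ℂ)))) y
      = expUnit (algebraMap ℂ 𝔸 (I * ((∑ r : Fin d → Fin L, ((L : ℝ) ^ d)⁻¹ * f (y + boxVec L r) : ℝ) : ℂ))) := by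
  rw [savg_apply, Sexp_cu L f y hf, cu_mul, sum_inv_card_mul_sub hL]
  congr 3
  push_cast; ring

end SiteAverage

/-! ## §3 [3]'s frames (85) and gauge fixings (76)–(77)+(87) of depth 1 and 2 on a pure gauge `g = e^{iψ}`, `U₀ = 1` -/

section DepthOneTwo

/-- ★ **THE DEPTH-1 FRAME (82)∕(85) of a pure gauge**: `w₁(z) = \overline{R_{0,Lz}(dg)} = exp(Σ_r L^{−d} log e^{i(ψ(Lz) − ψ(Lz+r))}) = e^{i(ψ(Lz) − M₁ψ(z))}`,
`M₁ψ(z) = Σ_r L^{−d}ψ(Lz + r)` the mean of the potential over the 1-block `B¹(z)` (smallness: `|ψ(Lz+r) − ψ(Lz)| < ln 2` on the block).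
[cite: Balaban1985Averaging, (82) p.30, (85) p.31, (110) p.34] -/
theorem wrec_one_cu (L : ℕ) (hL : 1 ≤ L) (ψ M₁ : Site d → ℝ)
    (hM₁ : ∀ z : Site d, M₁ z = ∑ r : Fin d → Fin L, ((L : ℝ) ^ d)⁻¹ * ψ ((L : ℤ) • z + boxVec L r))
    (z : Site d) (hψ : ∀ r : Fin d → Fin L, |ψ ((L : ℤ) • z + boxVec L r) - ψ ((L : ℤ) • z)| < Real.log 2) :
    wrec L (1 : Site d → Fin d → 𝔸ˣ) (gaugeAct (fun x => expUnit (algebraMap ℂ 𝔸 (I * ((ψ x : ℝ) : ℂ)))) 1) 1 z = expUnit (algebraMap ℂ 𝔸 (I * ((ψ ((L : ℤ) • z) - M₁ z : ℝ) : ℂ))) := by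
  rw [wrec_one, wframe_one_left]
  apply Units.ext
  rw [vframe, val_expUnit, val_expUnit]
  congr 1
  unfold Favg
  have hterm : ∀ r : Fin d → Fin L,
      mlog ((hol (gaugeAct (fun x => expUnit (algebraMap ℂ 𝔸 (I * ((ψ x : ℝ) : ℂ)))) (1 : Site d → Fin d → 𝔸ˣ)) ((L : ℤ) • z)
        (treeWord (boxVec L r)) : 𝔸ˣ) : 𝔸) = algebraMap ℂ 𝔸 (I * (((ψ ((L : ℤ) • z) - ψ ((L : ℤ) • z + boxVec L r) : ℝ)) : ℂ)) := by
    intro r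
    rw [hol_gaugeAct_one, disp_treeWord, cu_mul_inv, mlog_expUnit_algebraMap]
    rw [abs_sub_comm]; exact hψ r
  simp_rw [hterm, real_smul_algebraMap, ← map_sum]
  have hsum : ∑ r : Fin d → Fin L, ((L : ℝ) ^ d)⁻¹ * (ψ ((L : ℤ) • z) - ψ ((L : ℤ) • z + boxVec L r)) = ψ ((L : ℤ) • z) - M₁ z := by
    rw [hM₁ z]
    simp only [mul_sub, Finset.sum_sub_distrib, ← Finset.sum_mul, sum_inv_card_box hL, one_mul]
  rw [← hsum]
  congr 1
  push_cast
  rw [Finset.mul_sum]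
  exact Finset.sum_congr rfl fun r _ => by ring

/-- ★ **THE DEPTH-2 FRAME (85) of a pure gauge**: `w₂(w) = \overline{R_{0,L²w}(dg)}^{(2)} = e^{i(ψ(L²w) − M₂ψ(w))}`, `M₂ψ(w) = Σ_s L^{−d} M₁ψ(Lw + s)` the mean of the
potential over the 2-block `B²(w)` — (85) unfolded: the site average (78) over the level-1 block of `w` of `x ↦ \overline{dg}¹(Γ_{Lw,x})·w₁(x)`, where
`\overline{dg}¹ = d(g∘L·)` (§1) telescopes to `e^{i(ψ(L²w) − ψ(Lx))}` and `w₁(x) = e^{i(ψ(Lx) − M₁ψ(x))}` (smallness on both scales displayed).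
[cite: Balaban1985Averaging, (85) p.31, (78) p.30, (43) p.24] -/
theorem wrec_two_cu (L : ℕ) (hL : 1 ≤ L) (ψ M₁ M₂ : Site d → ℝ)
    (hM₁ : ∀ z : Site d, M₁ z = ∑ r : Fin d → Fin L, ((L : ℝ) ^ d)⁻¹ * ψ ((L : ℤ) • z + boxVec L r))
    (hM₂ : ∀ w : Site d, M₂ w = ∑ s : Fin d → Fin L, ((L : ℝ) ^ d)⁻¹ * M₁ ((L : ℤ) • w + boxVec L s)) (w : Site d)
    (hψ : ∀ (s r : Fin d → Fin L), |ψ ((L : ℤ) • ((L : ℤ) • w + boxVec L s) + boxVec L r) - ψ ((L : ℤ) • ((L : ℤ) • w + boxVec L s))| < Real.log 2)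
    (hM : ∀ s : Fin d → Fin L, |M₁ ((L : ℤ) • w + boxVec L s) - M₁ ((L : ℤ) • w)| < Real.log 2) :
    wrec L (1 : Site d → Fin d → 𝔸ˣ) (gaugeAct (fun x => expUnit (algebraMap ℂ 𝔸 (I * ((ψ x : ℝ) : ℂ)))) 1) 2 w = expUnit (algebraMap ℂ 𝔸 (I * ((ψ ((L : ℤ) • ((L : ℤ) • w)) - M₂ w : ℝ) : ℂ))) := by
  rw [wrec_succ, avgIter_one, tildIter_one_gaugeAct_one, R0fun_one_left]
  have hfun : (fun x => tHol (1 : Site d → Fin d → 𝔸ˣ) (gaugeAct (uLev L (fun x => expUnit (algebraMap ℂ 𝔸 (I * ((ψ x : ℝ) : ℂ)))) 1) 1) ((L : ℤ) • w)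
        (treeWord (x - (L : ℤ) • w)) * wrec L (1 : Site d → Fin d → 𝔸ˣ) (gaugeAct (fun x => expUnit (algebraMap ℂ 𝔸 (I * ((ψ x : ℝ) : ℂ)))) 1) 1 x)
      = fun x => expUnit (algebraMap ℂ 𝔸 (I * ((ψ ((L : ℤ) • ((L : ℤ) • w)) - ψ ((L : ℤ) • x) : ℝ) : ℂ))) * wrec L (1 : Site d → Fin d → 𝔸ˣ) (gaugeAct (fun x => expUnit (algebraMap ℂ 𝔸 (I * ((ψ x : ℝ) : ℂ)))) 1) 1 x := by
    funext x
    rw [tHol_one_gaugeAct_one, disp_treeWord, add_sub_cancel, uLev_apply, uLev_apply, pow_one, cu_mul_inv]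
  rw [hfun]
  -- on the block of `Lw` the depth-1 frame is in closed form, so the averaged function is `x ↦ e^{i(ψ(L²w) − M₁ψ(x))}`
  have hcongr : savg L (fun x => expUnit (algebraMap ℂ 𝔸 (I * ((ψ ((L : ℤ) • ((L : ℤ) • w)) - ψ ((L : ℤ) • x) : ℝ) : ℂ)))
          * wrec L (1 : Site d → Fin d → 𝔸ˣ) (gaugeAct (fun x => expUnit (algebraMap ℂ 𝔸 (I * ((ψ x : ℝ) : ℂ)))) 1) 1 x) ((L : ℤ) • w)
      = savg L (fun x => expUnit (algebraMap ℂ 𝔸 (I * ((ψ ((L : ℤ) • ((L : ℤ) • w)) - M₁ x : ℝ) : ℂ)))) ((L : ℤ) • w) := by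
    apply savg_congr
    · rw [wrec_one_cu L hL ψ M₁ hM₁ ((L : ℤ) • w) (by simpa using hψ (B7Eq84Concrete.bzero hL)), cu_mul]
      congr 4; ring
    · intro s
      rw [wrec_one_cu L hL ψ M₁ hM₁ ((L : ℤ) • w + boxVec L s) (hψ s), cu_mul]
      congr 4; ring
  rw [hcongr, savg_cu L hL _ _ (fun s => by rw [sub_sub_sub_cancel_left, abs_sub_comm]; exact hM s)]
  congr 4
  rw [hM₂ w]
  simp only [mul_sub, Finset.sum_sub_distrib, ← Finset.sum_mul, sum_inv_card_box hL, one_mul]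

/-- ★ **[3]'s DEPTH-1 GAUGE FIXING of a pure gauge** ((76) below the values (87), `k = 1`): `glev₁(x) = w₁(⌊x∕L⌋)⁻¹·(dg)(Γ_{L⌊x∕L⌋, x}) = e^{i(M₁ψ(⌊x∕L⌋) − ψ(x))}`
— `g(x)⁻¹` times the inverse of the BLOCK MEAN of `g⁻¹` (the averaging condition (81) normalises the block mean of `u`, not its value at the base point).
[cite: Balaban1985Averaging, (76) p.29, (87) p.31, (81) p.30] -/
theorem glev_one_cu (L : ℕ) (hL : 1 ≤ L) (ψ M₁ : Site d → ℝ)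
    (hM₁ : ∀ z : Site d, M₁ z = ∑ r : Fin d → Fin L, ((L : ℝ) ^ d)⁻¹ * ψ ((L : ℤ) • z + boxVec L r)) (x : Site d)
    (hψ : ∀ r : Fin d → Fin L, |ψ ((L : ℤ) • fl L x + boxVec L r) - ψ ((L : ℤ) • fl L x)| < Real.log 2) :
    glev L hL (1 : Site d → Fin d → 𝔸ˣ) (gaugeAct (fun x => expUnit (algebraMap ℂ 𝔸 (I * ((ψ x : ℝ) : ℂ)))) 1) 1 0 x = expUnit (algebraMap ℂ 𝔸 (I * ((M₁ (fl L x) - ψ x : ℝ) : ℂ))) := by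
  rw [glev_of_lt L hL _ _ Nat.zero_lt_one, avgIter_zero, hol_one, inv_one, Rc_one_apply, glev_top, tildIter_zero', tHol_one_left,
    hol_gaugeAct_one, disp_treeWord, fl_decomp hL x, wrec_one_cu L hL ψ M₁ hM₁ (fl L x) hψ, cu_inv, cu_mul_inv, cu_mul]
  congr 4; ring

/-- ★ **[3]'s DEPTH-2 GAUGE FIXING of a pure gauge** ((76)–(77) below the values (87), `k = 2`):
`glev₂(x) = w₂(⌊x∕L²⌋)⁻¹·\overline{dg}¹(Γ^{(1)})·(dg)(Γ) = e^{i(M₂ψ(⌊⌊x∕L⌋∕L⌋) − ψ(x))}` — `g(x)⁻¹` times the inverse of the 2-BLOCK MEAN of `g⁻¹`.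
[cite: Balaban1985Averaging, (76)–(77) pp.29–30, (87) p.31, (81) p.30] -/
theorem glev_two_cu (L : ℕ) (hL : 1 ≤ L) (ψ M₁ M₂ : Site d → ℝ)
    (hM₁ : ∀ z : Site d, M₁ z = ∑ r : Fin d → Fin L, ((L : ℝ) ^ d)⁻¹ * ψ ((L : ℤ) • z + boxVec L r))
    (hM₂ : ∀ w : Site d, M₂ w = ∑ s : Fin d → Fin L, ((L : ℝ) ^ d)⁻¹ * M₁ ((L : ℤ) • w + boxVec L s)) (x : Site d)
    (hψ : ∀ (s r : Fin d → Fin L), |ψ ((L : ℤ) • ((L : ℤ) • fl L (fl L x) + boxVec L s) + boxVec L r) - ψ ((L : ℤ) • ((L : ℤ) • fl L (fl L x) + boxVec L s))|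
      < Real.log 2)
    (hM : ∀ s : Fin d → Fin L, |M₁ ((L : ℤ) • fl L (fl L x) + boxVec L s) - M₁ ((L : ℤ) • fl L (fl L x))| < Real.log 2) :
    glev L hL (1 : Site d → Fin d → 𝔸ˣ) (gaugeAct (fun x => expUnit (algebraMap ℂ 𝔸 (I * ((ψ x : ℝ) : ℂ)))) 1) 2 0 x = expUnit (algebraMap ℂ 𝔸 (I * ((M₂ (fl L (fl L x)) - ψ x : ℝ) : ℂ))) := by
  -- level 0 → level 1: (76) at `j = 0`
  rw [glev_of_lt L hL _ _ Nat.zero_lt_two, avgIter_zero, hol_one, inv_one, Rc_one_apply, tildIter_zero', tHol_one_left, hol_gaugeAct_one,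
    disp_treeWord, fl_decomp hL x]
  -- level 1 → level 2: (76) at `j = 1` below the values (87)
  rw [glev_of_lt L hL _ _ Nat.one_lt_two, avgIter_one, hol_one, inv_one, Rc_one_apply, glev_top, tildIter_one_gaugeAct_one,
    tHol_one_gaugeAct_one, disp_treeWord, uLev_apply, uLev_apply, pow_one, fl_decomp hL (fl L x),
    wrec_two_cu L hL ψ M₁ M₂ hM₁ hM₂ (fl L (fl L x)) hψ hM, cu_inv, cu_mul_inv, cu_mul_inv, cu_mul, cu_mul]
  congr 4; ring

end DepthOneTwo

/-! ## §4 The transition function of the gauge-fixed pure gauge between a depth-2 tower and a depth-1 tower -/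

section Transition

/-- ★★ **THE INTER-TOWER TRANSITION FUNCTION**: let `u` be any gauge function which at the site `x` is [3]'s DEPTH-2 gauge fixing of the pure gauge
`U₁ = dg`, `g = e^{iψ}` (as print's tower-wise map is on a tower of depth 2) and at `x + e_μ` its DEPTH-1 gauge fixing (as on an adjacent tower of depth 1);
then the gauge-fixed bond variable (55) at `U₀ = 1` is `u(x)·g(x)g(x+e_μ)⁻¹·u(x+e_μ)⁻¹ = e^{i(M₂ψ(⌊x∕L²⌋) − M₁ψ(⌊(x+e_μ)∕L⌋))}` — the difference of the
MEANS of the potential over the two towers; the bond's own variable cancels.  (For two towers of the SAME depth `j` this is [3]'s (88)∕(92)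
`Ũ′ʲ = U̿₁ʲ`; across depths it is not of that form — the located mechanism behind the box-form failure of [Balaban1985RegularSpaces] (1.145) at
constant `2`, `B8Prop7PrintedRZdGF3BoxFormInterTower`.) [cite: Balaban1985Averaging, (55) p.27, (76)–(77) pp.29–30, (87) p.31, (88) p.31; Balaban1985RegularSpaces, Prop. 7 (1.145) p.100] -/
theorem mgauge_interTower_cu (L : ℕ) (hL : 1 ≤ L) (ψ M₁ M₂ : Site d → ℝ)
    (hM₁ : ∀ z : Site d, M₁ z = ∑ r : Fin d → Fin L, ((L : ℝ) ^ d)⁻¹ * ψ ((L : ℤ) • z + boxVec L r))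
    (hM₂ : ∀ w : Site d, M₂ w = ∑ s : Fin d → Fin L, ((L : ℝ) ^ d)⁻¹ * M₁ ((L : ℤ) • w + boxVec L s))
    (u : Site d → 𝔸ˣ) (x : Site d) (μ : Fin d)
    (hux : u x = glev L hL (1 : Site d → Fin d → 𝔸ˣ) (gaugeAct (fun x => expUnit (algebraMap ℂ 𝔸 (I * ((ψ x : ℝ) : ℂ)))) 1) 2 0 x)
    (huxe : u (x + e μ) = glev L hL (1 : Site d → Fin d → 𝔸ˣ) (gaugeAct (fun x => expUnit (algebraMap ℂ 𝔸 (I * ((ψ x : ℝ) : ℂ)))) 1) 1 0 (x + e μ))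
    (hψ2 : ∀ (s r : Fin d → Fin L), |ψ ((L : ℤ) • ((L : ℤ) • fl L (fl L x) + boxVec L s) + boxVec L r) - ψ ((L : ℤ) • ((L : ℤ) • fl L (fl L x) + boxVec L s))|
      < Real.log 2)
    (hM2 : ∀ s : Fin d → Fin L, |M₁ ((L : ℤ) • fl L (fl L x) + boxVec L s) - M₁ ((L : ℤ) • fl L (fl L x))| < Real.log 2)
    (hψ1 : ∀ r : Fin d → Fin L, |ψ ((L : ℤ) • fl L (x + e μ) + boxVec L r) - ψ ((L : ℤ) • fl L (x + e μ))| < Real.log 2) :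
    mgauge (1 : Site d → Fin d → 𝔸ˣ) u (gaugeAct (fun x => expUnit (algebraMap ℂ 𝔸 (I * ((ψ x : ℝ) : ℂ)))) 1) x μ = expUnit (algebraMap ℂ 𝔸 (I * ((M₂ (fl L (fl L x)) - M₁ (fl L (x + e μ)) : ℝ) : ℂ))) := by
  rw [mgauge_apply, Pi.one_apply, Pi.one_apply, Rc_one_apply, hux, huxe, gaugeAct_one_apply,
    glev_two_cu L hL ψ M₁ M₂ hM₁ hM₂ x hψ2 hM2, glev_one_cu L hL ψ M₁ hM₁ (x + e μ) hψ1,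
    cu_mul_inv, cu_mul, cu_mul_inv]
  congr 4; ring

/-- The same read as the value of the transformed field `(U₁^u·U₀)(x, x+e_μ)` at `U₀ = 1` and its distance to `U₀ = 1`:
`‖(U₁^u·1)(x,μ) − 1‖ = 2|sin((M₂ψ − M₁ψ)∕2)|` — the left member of the box-form (1.145) at level `0` on that bond.
[cite: Balaban1985RegularSpaces, Prop. 7 (1.145) p.100; Balaban1985Averaging, (55) p.27] -/
theorem norm_mgauge_interTower_sub_one_cu (L : ℕ) (hL : 1 ≤ L) (ψ M₁ M₂ : Site d → ℝ)
    (hM₁ : ∀ z : Site d, M₁ z = ∑ r : Fin d → Fin L, ((L : ℝ) ^ d)⁻¹ * ψ ((L : ℤ) • z + boxVec L r))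
    (hM₂ : ∀ w : Site d, M₂ w = ∑ s : Fin d → Fin L, ((L : ℝ) ^ d)⁻¹ * M₁ ((L : ℤ) • w + boxVec L s))
    (u : Site d → 𝔸ˣ) (x : Site d) (μ : Fin d)
    (hux : u x = glev L hL (1 : Site d → Fin d → 𝔸ˣ) (gaugeAct (fun x => expUnit (algebraMap ℂ 𝔸 (I * ((ψ x : ℝ) : ℂ)))) 1) 2 0 x)
    (huxe : u (x + e μ) = glev L hL (1 : Site d → Fin d → 𝔸ˣ) (gaugeAct (fun x => expUnit (algebraMap ℂ 𝔸 (I * ((ψ x : ℝ) : ℂ)))) 1) 1 0 (x + e μ))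
    (hψ2 : ∀ (s r : Fin d → Fin L), |ψ ((L : ℤ) • ((L : ℤ) • fl L (fl L x) + boxVec L s) + boxVec L r) - ψ ((L : ℤ) • ((L : ℤ) • fl L (fl L x) + boxVec L s))|
      < Real.log 2)
    (hM2 : ∀ s : Fin d → Fin L, |M₁ ((L : ℤ) • fl L (fl L x) + boxVec L s) - M₁ ((L : ℤ) • fl L (fl L x))| < Real.log 2)
    (hψ1 : ∀ r : Fin d → Fin L, |ψ ((L : ℤ) • fl L (x + e μ) + boxVec L r) - ψ ((L : ℤ) • fl L (x + e μ))| < Real.log 2) :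
    ‖(((mgauge (1 : Site d → Fin d → 𝔸ˣ) u (gaugeAct (fun x => expUnit (algebraMap ℂ 𝔸 (I * ((ψ x : ℝ) : ℂ)))) 1) * (1 : Site d → Fin d → 𝔸ˣ)) x μ : 𝔸ˣ) : 𝔸)
        - (((1 : Site d → Fin d → 𝔸ˣ) x μ : 𝔸ˣ) : 𝔸)‖
      = 2 * |Real.sin ((M₂ (fl L (fl L x)) - M₁ (fl L (x + e μ))) / 2)| := by
  rw [Pi.mul_apply, Pi.one_apply, mul_one, mgauge_interTower_cu L hL ψ M₁ M₂ hM₁ hM₂ u x μ hux huxe hψ2 hM2 hψ1, Pi.one_apply,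
    Units.val_one, norm_cu_sub_one]

end Transition

end Literature.MathematicalPhysics.QuantumFieldTheory.Balaban1983to89.B7GaugeFixingPureGaugeCStar

end
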